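import Summits.Ventures.PercRepro.StepiiCounterexample

/-!
# The marked rows of `g3 = gadget + v–m₄`, certified (p6, gen 6)

`g3` is the gadget `g0` of `StepiiCounterexample.lean` with one more edge `8 = v–m₄` (`5–3`): the
smallest member of the «`v` joined to the hub's pendant mark» family, where the `Z`-fibre
copositivity certificates of gen 5 failed.  `G3Lemma5.lean` proves Lemma 5 on it for every weight
vector by the class-level PAIR certificate of `PairCert.lean`; that proof reads the merge vectors of
the `512` fully forced patterns through the table certified here.

The table is split along the new edge: when `v–m₄` is closed the marked partition of `g3` is that
of `g0` on the restricted configuration (**`rowD3_of_closed`** — connectivity does not see a closed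
edge), so that half is the gadget's certified table `rowD_eq_table`; when `v–m₄` is open the `256`
rows are certified by kernel computation in chunks (`rowD3_eq_table_0..3` of `32` configurations
and `rowD3_eq_table_4..7` assembled from sub-chunks of `8`, six breadth-first connectivities each;
the configurations with `v–m₂` open have larger clusters and cost more kernel time).

* `g3`, `restrict8`, `rowD3`, `rowD3_eq`, `rowTableHi`, `rowT3`;
* `openAdj_g3_iff_of_closed`, `conn_g3_iff_of_closed`, `rowD3_of_closed`;
* **`rowD3_eq_table`** : `∀ ω, rowD3 ω = rowT3 ω`.
-/

-- the kernel checks below are heavy; elaborate them one at a time (memory; p3 g9 finding 21:02:37Z)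
set_option Elab.async false

namespace PercRepro

open Finset

/-- The graph `g3`: the gadget `g0` (marks `0, 1, 2, 3`, hubs `4, 5`, edges `b–c, d–4, a–5, c–5,
c–4, a–b, b–4, 4–5`) plus the edge `8 = 5–3` (`v–m₄`). -/
def g3 : MultiGraph (Fin 6) (Fin 9) := ⟨![1, 3, 5, 2, 2, 1, 4, 4, 5], ![2, 4, 0, 5, 4, 0, 1, 5, 3]⟩

/-- The restriction of a configuration of `g3` to the eight edges of `g0`. -/
def restrict8 (ω : Config (Fin 9)) : Config (Fin 8) := fun i => ω (Fin.castSucc i)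

/-- The first endpoints of the gadget edges are unchanged in `g3` (kernel-checked). -/
theorem g3_fst_castSucc : ∀ e : Fin 8, g3.fst (Fin.castSucc e) = g0.fst e := by decide

/-- The second endpoints of the gadget edges are unchanged in `g3` (kernel-checked). -/
theorem g3_snd_castSucc : ∀ e : Fin 8, g3.snd (Fin.castSucc e) = g0.snd e := by decide

/-- With `v–m₄` closed, open adjacency in `g3` is open adjacency in `g0`. -/
theorem openAdj_g3_iff_of_closed {ω : Config (Fin 9)} (h8 : ω 8 = false) (a b : Fin 6) :
    g3.OpenAdj ω a b ↔ g0.OpenAdj (restrict8 ω) a b := by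
  constructor
  · rintro ⟨e, he, hab⟩
    rcases Fin.eq_castSucc_or_eq_last e with ⟨e', rfl⟩ | rfl
    · exact ⟨e', he, by simpa [g3_fst_castSucc, g3_snd_castSucc] using hab⟩
    · exact absurd he (by simpa using h8)
  · rintro ⟨e', he, hab⟩
    exact ⟨Fin.castSucc e', he, by simpa [g3_fst_castSucc, g3_snd_castSucc] using hab⟩

/-- With `v–m₄` closed, connectivity in `g3` is connectivity in `g0`. -/
theorem conn_g3_iff_of_closed {ω : Config (Fin 9)} (h8 : ω 8 = false) (u v : Fin 6) :
    g3.Conn ω u v ↔ g0.Conn (restrict8 ω) u v :=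
  ⟨fun hc => Relation.ReflTransGen.mono (fun a b hab => (openAdj_g3_iff_of_closed h8 a b).mp hab) u v hc,
    fun hc => Relation.ReflTransGen.mono (fun a b hab => (openAdj_g3_iff_of_closed h8 a b).mpr hab) u v hc⟩

/-- The computable row of a configuration of `g3` (`ConnD.lean` breadth-first connectivities of
the marks through typer-2's `rowOf4`). -/
def rowD3 (ω : Config (Fin 9)) : Fin 15 :=
  rowOf4 fun a => g3.connD ω (m0 (pair4 a).1) (m0 (pair4 a).2)

/-- The computable row is the row of the marked partition. -/
theorem rowD3_eq (ω : Config (Fin 9)) : row4 (g3.markedPartition ω m0) = rowD3 ω := by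
  unfold row4 rowD3
  congr 1
  funext a
  rw [MultiGraph.atoms4_markedPartition, MultiGraph.connD_eq_decide]
  exact decide_eq_decide.2 Iff.rfl

/-- With `v–m₄` closed the row of `g3` is the row of `g0` on the restriction. -/
theorem rowD3_of_closed {ω : Config (Fin 9)} (h8 : ω 8 = false) : rowD3 ω = rowD (restrict8 ω) := by
  unfold rowD3 rowD
  refine congrArg rowOf4 ?_
  funext a
  rw [MultiGraph.connD_eq_decide, MultiGraph.connD_eq_decide]
  exact decide_eq_decide.2 (conn_g3_iff_of_closed h8 _ _)

/-- The rows of the 256 configurations of `g3` with `v–m₄` OPEN, indexed by the `code` of the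
restriction (computed by p6's enumerator from the edge list, two implementations; certified below). -/
def rowTableHi : List (Fin 15) :=
  [14, 10, 14, 10, 11, 8, 11, 8, 13, 9, 13, 9, 5, 0, 5, 0, 14, 10, 13, 9, 11, 8, 5, 0, 13, 9, 13,
   9, 5, 0, 5, 0, 4, 1, 4, 1, 2, 0, 2, 0, 3, 0, 3, 0, 0, 0, 0, 0, 4, 1, 3, 0, 2, 0, 0, 0, 3, 0,
   3, 0, 0, 0, 0, 0, 14, 10, 12, 9, 11, 8, 2, 0, 13, 9, 9, 9, 5, 0, 0, 0, 10, 10, 9, 9, 8, 8, 0,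
   0, 9, 9, 9, 9, 0, 0, 0, 0, 4, 1, 2, 0, 2, 0, 2, 0, 3, 0, 0, 0, 0, 0, 0, 0, 1, 1, 0, 0, 0, 0,
   0, 0, 0, 0, 0, 0, 0, 0, 0, 0, 14, 10, 14, 10, 11, 8, 11, 8, 13, 9, 13, 9, 5, 0, 5, 0, 13, 9,
   13, 9, 5, 0, 5, 0, 13, 9, 13, 9, 5, 0, 5, 0, 4, 1, 4, 1, 2, 0, 2, 0, 3, 0, 3, 0, 0, 0, 0, 0,
   3, 0, 3, 0, 0, 0, 0, 0, 3, 0, 3, 0, 0, 0, 0, 0, 12, 9, 12, 9, 2, 0, 2, 0, 9, 9, 9, 9, 0, 0, 0,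
   0, 9, 9, 9, 9, 0, 0, 0, 0, 9, 9, 9, 9, 0, 0, 0, 0, 2, 0, 2, 0, 2, 0, 2, 0, 0, 0, 0, 0, 0, 0,
   0, 0, 0, 0, 0, 0, 0, 0, 0, 0, 0, 0, 0, 0, 0, 0, 0, 0]

/-- The table lookup: the gadget's certified table when `v–m₄` is closed, `rowTableHi` when open. -/
def rowT3 (ω : Config (Fin 9)) : Fin 15 :=
  if ω 8 then rowTableHi.getD (code (restrict8 ω)) 0 else rowT (restrict8 ω)

/-- Every configuration of `g3` is the vector of its nine coordinates. -/
theorem config9_eta (ω : Config (Fin 9)) :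
    ω = ![ω 0, ω 1, ω 2, ω 3, ω 4, ω 5, ω 6, ω 7, ω 8] := by
  funext i
  fin_cases i <;> rfl

/-- Table chunk `0` (edge `v–m₄` open): the 32 configurations with
`(ω 0, ω 1, ω 2, ω 8) = (false, false, false, true)`. -/
theorem rowD3_eq_table_0 : ∀ b3 b4 b5 b6 b7 : Bool,
    rowD3 ![false, false, false, b3, b4, b5, b6, b7, true] =
      rowT3 ![false, false, false, b3, b4, b5, b6, b7, true] := by
  intro b3 b4 b5 b6 b7
  cases b3 <;> cases b4 <;> cases b5 <;> cases b6 <;> cases b7 <;> decide +kernel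
/-- Table chunk `1` (edge `v–m₄` open): the 32 configurations with
`(ω 0, ω 1, ω 2, ω 8) = (true, false, false, true)`. -/
theorem rowD3_eq_table_1 : ∀ b3 b4 b5 b6 b7 : Bool,
    rowD3 ![true, false, false, b3, b4, b5, b6, b7, true] =
      rowT3 ![true, false, false, b3, b4, b5, b6, b7, true] := by
  intro b3 b4 b5 b6 b7
  cases b3 <;> cases b4 <;> cases b5 <;> cases b6 <;> cases b7 <;> decide +kernel
/-- Table chunk `2` (edge `v–m₄` open): the 32 configurations with
`(ω 0, ω 1, ω 2, ω 8) = (false, true, false, true)`. -/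
theorem rowD3_eq_table_2 : ∀ b3 b4 b5 b6 b7 : Bool,
    rowD3 ![false, true, false, b3, b4, b5, b6, b7, true] =
      rowT3 ![false, true, false, b3, b4, b5, b6, b7, true] := by
  intro b3 b4 b5 b6 b7
  cases b3 <;> cases b4 <;> cases b5 <;> cases b6 <;> cases b7 <;> decide +kernel
/-- Table chunk `3` (edge `v–m₄` open): the 32 configurations with
`(ω 0, ω 1, ω 2, ω 8) = (true, true, false, true)`. -/
theorem rowD3_eq_table_3 : ∀ b3 b4 b5 b6 b7 : Bool,
    rowD3 ![true, true, false, b3, b4, b5, b6, b7, true] =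
      rowT3 ![true, true, false, b3, b4, b5, b6, b7, true] := by
  intro b3 b4 b5 b6 b7
  cases b3 <;> cases b4 <;> cases b5 <;> cases b6 <;> cases b7 <;> decide +kernel
/-- Table chunk `4.0` (edge `v–m₄` open): the 8 configurations with
`(ω 0, ω 1, ω 2, ω 3, ω 4, ω 8) = (false, false, true, false, false, true)`. -/
theorem rowD3_eq_table_4_0 : ∀ b5 b6 b7 : Bool,
    rowD3 ![false, false, true, false, false, b5, b6, b7, true] =
      rowT3 ![false, false, true, false, false, b5, b6, b7, true] := by
  intro b5 b6 b7
  cases b5 <;> cases b6 <;> cases b7 <;> decide +kernel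

/-- Table chunk `4.1` (edge `v–m₄` open): the 8 configurations with
`(ω 0, ω 1, ω 2, ω 3, ω 4, ω 8) = (false, false, true, true, false, true)`. -/
theorem rowD3_eq_table_4_1 : ∀ b5 b6 b7 : Bool,
    rowD3 ![false, false, true, true, false, b5, b6, b7, true] =
      rowT3 ![false, false, true, true, false, b5, b6, b7, true] := by
  intro b5 b6 b7
  cases b5 <;> cases b6 <;> cases b7 <;> decide +kernel

/-- Table chunk `4.2` (edge `v–m₄` open): the 8 configurations with
`(ω 0, ω 1, ω 2, ω 3, ω 4, ω 8) = (false, false, true, false, true, true)`. -/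
theorem rowD3_eq_table_4_2 : ∀ b5 b6 b7 : Bool,
    rowD3 ![false, false, true, false, true, b5, b6, b7, true] =
      rowT3 ![false, false, true, false, true, b5, b6, b7, true] := by
  intro b5 b6 b7
  cases b5 <;> cases b6 <;> cases b7 <;> decide +kernel

/-- Table chunk `4.3` (edge `v–m₄` open): the 8 configurations with
`(ω 0, ω 1, ω 2, ω 3, ω 4, ω 8) = (false, false, true, true, true, true)`. -/
theorem rowD3_eq_table_4_3 : ∀ b5 b6 b7 : Bool,
    rowD3 ![false, false, true, true, true, b5, b6, b7, true] =
      rowT3 ![false, false, true, true, true, b5, b6, b7, true] := by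
  intro b5 b6 b7
  cases b5 <;> cases b6 <;> cases b7 <;> decide +kernel

/-- Table chunk `4` (edge `v–m₄` open), assembled from its four sub-chunks. -/
theorem rowD3_eq_table_4 : ∀ b3 b4 b5 b6 b7 : Bool,
    rowD3 ![false, false, true, b3, b4, b5, b6, b7, true] =
      rowT3 ![false, false, true, b3, b4, b5, b6, b7, true] := by
  intro b3 b4 b5 b6 b7
  cases b3 <;> cases b4
  · exact rowD3_eq_table_4_0 _ _ _
  · exact rowD3_eq_table_4_2 _ _ _
  · exact rowD3_eq_table_4_1 _ _ _
  · exact rowD3_eq_table_4_3 _ _ _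

/-- Table chunk `5.0` (edge `v–m₄` open): the 8 configurations with
`(ω 0, ω 1, ω 2, ω 3, ω 4, ω 8) = (true, false, true, false, false, true)`. -/
theorem rowD3_eq_table_5_0 : ∀ b5 b6 b7 : Bool,
    rowD3 ![true, false, true, false, false, b5, b6, b7, true] =
      rowT3 ![true, false, true, false, false, b5, b6, b7, true] := by
  intro b5 b6 b7
  cases b5 <;> cases b6 <;> cases b7 <;> decide +kernel

/-- Table chunk `5.1` (edge `v–m₄` open): the 8 configurations with
`(ω 0, ω 1, ω 2, ω 3, ω 4, ω 8) = (true, false, true, true, false, true)`. -/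
theorem rowD3_eq_table_5_1 : ∀ b5 b6 b7 : Bool,
    rowD3 ![true, false, true, true, false, b5, b6, b7, true] =
      rowT3 ![true, false, true, true, false, b5, b6, b7, true] := by
  intro b5 b6 b7
  cases b5 <;> cases b6 <;> cases b7 <;> decide +kernel

/-- Table chunk `5.2` (edge `v–m₄` open): the 8 configurations with
`(ω 0, ω 1, ω 2, ω 3, ω 4, ω 8) = (true, false, true, false, true, true)`. -/
theorem rowD3_eq_table_5_2 : ∀ b5 b6 b7 : Bool,
    rowD3 ![true, false, true, false, true, b5, b6, b7, true] =
      rowT3 ![true, false, true, false, true, b5, b6, b7, true] := by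
  intro b5 b6 b7
  cases b5 <;> cases b6 <;> cases b7 <;> decide +kernel

/-- Table chunk `5.3` (edge `v–m₄` open): the 8 configurations with
`(ω 0, ω 1, ω 2, ω 3, ω 4, ω 8) = (true, false, true, true, true, true)`. -/
theorem rowD3_eq_table_5_3 : ∀ b5 b6 b7 : Bool,
    rowD3 ![true, false, true, true, true, b5, b6, b7, true] =
      rowT3 ![true, false, true, true, true, b5, b6, b7, true] := by
  intro b5 b6 b7
  cases b5 <;> cases b6 <;> cases b7 <;> decide +kernel

/-- Table chunk `5` (edge `v–m₄` open), assembled from its four sub-chunks. -/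
theorem rowD3_eq_table_5 : ∀ b3 b4 b5 b6 b7 : Bool,
    rowD3 ![true, false, true, b3, b4, b5, b6, b7, true] =
      rowT3 ![true, false, true, b3, b4, b5, b6, b7, true] := by
  intro b3 b4 b5 b6 b7
  cases b3 <;> cases b4
  · exact rowD3_eq_table_5_0 _ _ _
  · exact rowD3_eq_table_5_2 _ _ _
  · exact rowD3_eq_table_5_1 _ _ _
  · exact rowD3_eq_table_5_3 _ _ _

/-- Table chunk `6.0` (edge `v–m₄` open): the 8 configurations with
`(ω 0, ω 1, ω 2, ω 3, ω 4, ω 8) = (false, true, true, false, false, true)`. -/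
theorem rowD3_eq_table_6_0 : ∀ b5 b6 b7 : Bool,
    rowD3 ![false, true, true, false, false, b5, b6, b7, true] =
      rowT3 ![false, true, true, false, false, b5, b6, b7, true] := by
  intro b5 b6 b7
  cases b5 <;> cases b6 <;> cases b7 <;> decide +kernel

/-- Table chunk `6.1` (edge `v–m₄` open): the 8 configurations with
`(ω 0, ω 1, ω 2, ω 3, ω 4, ω 8) = (false, true, true, true, false, true)`. -/
theorem rowD3_eq_table_6_1 : ∀ b5 b6 b7 : Bool,
    rowD3 ![false, true, true, true, false, b5, b6, b7, true] =
      rowT3 ![false, true, true, true, false, b5, b6, b7, true] := by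
  intro b5 b6 b7
  cases b5 <;> cases b6 <;> cases b7 <;> decide +kernel

/-- Table chunk `6.2` (edge `v–m₄` open): the 8 configurations with
`(ω 0, ω 1, ω 2, ω 3, ω 4, ω 8) = (false, true, true, false, true, true)`. -/
theorem rowD3_eq_table_6_2 : ∀ b5 b6 b7 : Bool,
    rowD3 ![false, true, true, false, true, b5, b6, b7, true] =
      rowT3 ![false, true, true, false, true, b5, b6, b7, true] := by
  intro b5 b6 b7
  cases b5 <;> cases b6 <;> cases b7 <;> decide +kernel

/-- Table chunk `6.3` (edge `v–m₄` open): the 8 configurations with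
`(ω 0, ω 1, ω 2, ω 3, ω 4, ω 8) = (false, true, true, true, true, true)`. -/
theorem rowD3_eq_table_6_3 : ∀ b5 b6 b7 : Bool,
    rowD3 ![false, true, true, true, true, b5, b6, b7, true] =
      rowT3 ![false, true, true, true, true, b5, b6, b7, true] := by
  intro b5 b6 b7
  cases b5 <;> cases b6 <;> cases b7 <;> decide +kernel

/-- Table chunk `6` (edge `v–m₄` open), assembled from its four sub-chunks. -/
theorem rowD3_eq_table_6 : ∀ b3 b4 b5 b6 b7 : Bool,
    rowD3 ![false, true, true, b3, b4, b5, b6, b7, true] =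
      rowT3 ![false, true, true, b3, b4, b5, b6, b7, true] := by
  intro b3 b4 b5 b6 b7
  cases b3 <;> cases b4
  · exact rowD3_eq_table_6_0 _ _ _
  · exact rowD3_eq_table_6_2 _ _ _
  · exact rowD3_eq_table_6_1 _ _ _
  · exact rowD3_eq_table_6_3 _ _ _

/-- Table chunk `7.0` (edge `v–m₄` open): the 8 configurations with
`(ω 0, ω 1, ω 2, ω 3, ω 4, ω 8) = (true, true, true, false, false, true)`. -/
theorem rowD3_eq_table_7_0 : ∀ b5 b6 b7 : Bool,
    rowD3 ![true, true, true, false, false, b5, b6, b7, true] =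
      rowT3 ![true, true, true, false, false, b5, b6, b7, true] := by
  intro b5 b6 b7
  cases b5 <;> cases b6 <;> cases b7 <;> decide +kernel

/-- Table chunk `7.1` (edge `v–m₄` open): the 8 configurations with
`(ω 0, ω 1, ω 2, ω 3, ω 4, ω 8) = (true, true, true, true, false, true)`. -/
theorem rowD3_eq_table_7_1 : ∀ b5 b6 b7 : Bool,
    rowD3 ![true, true, true, true, false, b5, b6, b7, true] =
      rowT3 ![true, true, true, true, false, b5, b6, b7, true] := by
  intro b5 b6 b7
  cases b5 <;> cases b6 <;> cases b7 <;> decide +kernel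

/-- Table chunk `7.2` (edge `v–m₄` open): the 8 configurations with
`(ω 0, ω 1, ω 2, ω 3, ω 4, ω 8) = (true, true, true, false, true, true)`. -/
theorem rowD3_eq_table_7_2 : ∀ b5 b6 b7 : Bool,
    rowD3 ![true, true, true, false, true, b5, b6, b7, true] =
      rowT3 ![true, true, true, false, true, b5, b6, b7, true] := by
  intro b5 b6 b7
  cases b5 <;> cases b6 <;> cases b7 <;> decide +kernel

/-- Table chunk `7.3` (edge `v–m₄` open): the 8 configurations with
`(ω 0, ω 1, ω 2, ω 3, ω 4, ω 8) = (true, true, true, true, true, true)`. -/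
theorem rowD3_eq_table_7_3 : ∀ b5 b6 b7 : Bool,
    rowD3 ![true, true, true, true, true, b5, b6, b7, true] =
      rowT3 ![true, true, true, true, true, b5, b6, b7, true] := by
  intro b5 b6 b7
  cases b5 <;> cases b6 <;> cases b7 <;> decide +kernel

/-- Table chunk `7` (edge `v–m₄` open), assembled from its four sub-chunks. -/
theorem rowD3_eq_table_7 : ∀ b3 b4 b5 b6 b7 : Bool,
    rowD3 ![true, true, true, b3, b4, b5, b6, b7, true] =
      rowT3 ![true, true, true, b3, b4, b5, b6, b7, true] := by
  intro b3 b4 b5 b6 b7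
  cases b3 <;> cases b4
  · exact rowD3_eq_table_7_0 _ _ _
  · exact rowD3_eq_table_7_2 _ _ _
  · exact rowD3_eq_table_7_1 _ _ _
  · exact rowD3_eq_table_7_3 _ _ _

/-- **The table is correct**: the closed-`v–m₄` half by `rowD3_of_closed` and the gadget's certified
table, the open half by 256 closed instances (chunks of 32 and of 8) of six breadth-first
connectivities each, by kernel computation. -/
theorem rowD3_eq_table : ∀ ω : Config (Fin 9), rowD3 ω = rowT3 ω := by
  intro ω
  by_cases h8 : ω 8 = true
  · rw [config9_eta ω, h8]
    generalize ω 0 = b0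
    generalize ω 1 = b1
    generalize ω 2 = b2
    cases b0 <;> cases b1 <;> cases b2
    · exact rowD3_eq_table_0 _ _ _ _ _
    · exact rowD3_eq_table_4 _ _ _ _ _
    · exact rowD3_eq_table_2 _ _ _ _ _
    · exact rowD3_eq_table_6 _ _ _ _ _
    · exact rowD3_eq_table_1 _ _ _ _ _
    · exact rowD3_eq_table_5 _ _ _ _ _
    · exact rowD3_eq_table_3 _ _ _ _ _
    · exact rowD3_eq_table_7 _ _ _ _ _
  · have h8' : ω 8 = false := by simpa using h8
    rw [rowD3_of_closed h8', rowD_eq_table]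
    simp [rowT3, h8']

end PercRepro
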